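import Mathlib
import HarnessLib.Audit
import Summits.PneNP.PneNP.Theorems.PstarChordBridgeTools
import Summits.PneNP.PneNP.Theorems.PstarChordEndgameTools

/-!
# Path-free combinatorics of a fundamental set (ROUND-24, memo §9 R3; companion of `PstarChordBridge`)

FRONTIER range-avoidance ladder, rung F-N3, ROUND 24 (cell `pnp-ideate`, planner memo `r24/CORE-BOUND-NOTES.md` §7 G2′ / §9 R3 ("every fundamental
path `P_e` has length `≥ 2` and two consecutive path edges share an XOR vertex hence no AND variable"); restricted-model proof complexity —
nothing here bears on `P` versus `NP`).

In the bridge (`PstarChordBridge`) the fundamental path of a chord `e` is replaced by a FUNDAMENTAL SET `D` with `e ∉ D` and `D + e` everywhere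
even in the XOR multigraph (slot-degrees `PstarChordBridgeTools.xpdeg`).  From this parity condition and simple overlaps ALONE (no paths, no
connectivity) the three combinatorial hypotheses of `PstarPathRank.rank_four_of_family` follow:

* `mem_xpair_of_odd`, `odd_of_end` — the odd vertices of `D` are exactly the two XOR ends of `e`;
* `two_le_card_of_even` — `#D ≥ 2` (one output would be parallel to `e`);
* `not_star_of_even` — no AND variable is common to all outputs of `D` (outputs sharing an AND variable are XOR-disjoint by simple overlaps, so
  `D` would be an XOR matching with all slot-degrees `≤ 1`; evenness then leaves one output parallel to `e`) — uses the double count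
  `sum_xpdeg : Σ_w xpdeg_D(w) = 2·#D`;
* `card_xor_bdry_le_two_of_even` — at most two boundary variables of `D` lie outside all AND pairs of `D` (such a variable is an odd vertex);
* `eq_of_fundamental_eq` — two outputs with the same fundamental set are equal (their XOR pairs coincide; simple overlaps).
-/

set_option linter.dupNamespace false -- `Summit.PneNP.PneNP.…`: summit = sub-problem name (D-0017 single-conjunct layout)

open Finset Literature.Computability.Complexity
open Summit.PneNP.PneNP.Theorems.PstarSALevel (varSet bdry SimpleOverlap)
open Summit.PneNP.PneNP.Theorems.PstarGapLinearised (andPair andPair_subset_varSet)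
open Summit.PneNP.PneNP.Theorems.PstarChordEndgameTools (not_two_shared mem_andPair_iff)
open Summit.PneNP.PneNP.Theorems.PstarCentreFree (vars_mem_varSet)
open Summit.PneNP.PneNP.Theorems.PstarXorElimination (pdeg)
open Summit.PneNP.PneNP.Theorems.PstarXCore (xpair xverts mem_xpair card_xpair_le)
open Summit.PneNP.PneNP.Theorems.PstarChordBridgeTools

namespace Summit.PneNP.PneNP.Theorems.PstarChordBridgeFundamental

variable {n m : ℕ}

/-! ## Path-free combinatorics of a fundamental set -/

/-- Slot-degree after inserting an output. -/
theorem xpdeg_insert (I : LocalMap 4 n m) {D : Finset (Fin m)} {e : Fin m} (he : e ∉ D) (w : Fin n) :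
    xpdeg I (insert e D) w = xpdeg I D w + (if I.vars e 0 = w then 1 else 0) + (if I.vars e 1 = w then 1 else 0) := by
  unfold xpdeg pdeg
  rw [filter_insert, filter_insert]
  by_cases h0 : I.vars e 0 = w <;> by_cases h1 : I.vars e 1 = w <;>
    simp [h0, h1, card_insert_of_notMem (fun h => he (mem_filter.1 h).1)] <;> omega

/-- **Odd vertices of `D` are ends of `e`** when `D + e` is everywhere even. -/
theorem mem_xpair_of_odd (I : LocalMap 4 n m) {D : Finset (Fin m)} {e : Fin m} (he : e ∉ D)
    (heven : ∀ w, Even (xpdeg I (insert e D) w)) {w : Fin n} (hw : Odd (xpdeg I D w)) : w ∈ xpair I e := by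
  have h := heven w
  rw [xpdeg_insert I he] at h
  rw [mem_xpair]
  by_contra hnot
  push Not at hnot
  rw [if_neg (Ne.symm hnot.1), if_neg (Ne.symm hnot.2), add_zero, add_zero] at h
  exact (Nat.not_even_iff_odd.2 hw) h

/-- **The ends of `e` are odd vertices of `D`** (pure instance: the two XOR slots differ). -/
theorem odd_of_end (I : LocalMap 4 n m) (hI : I.IsPure xorAndPred) {D : Finset (Fin m)} {e : Fin m} (he : e ∉ D)
    (heven : ∀ w, Even (xpdeg I (insert e D) w)) {s : Fin 4} (hs : s.val < 2) : Odd (xpdeg I D (I.vars e s)) := by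
  have h := heven (I.vars e s)
  rw [xpdeg_insert I he] at h
  have h01 : I.vars e 0 ≠ I.vars e 1 := fun h => absurd (hI.2 e h) (by decide)
  have : s = 0 ∨ s = 1 := by
    rcases s with ⟨s, h4⟩
    simp only [Fin.ext_iff] at *
    omega
  rcases this with rfl | rfl
  · rw [if_pos rfl, if_neg (Ne.symm h01)] at h
    by_contra hodd
    rw [Nat.not_odd_iff_even] at hodd
    exact Nat.not_even_iff_odd.2 (Even.add_one hodd) (by simpa using h)
  · rw [if_neg h01, if_pos rfl] at h
    by_contra hodd
    rw [Nat.not_odd_iff_even] at hodd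
    exact Nat.not_even_iff_odd.2 (Even.add_one hodd) (by simpa using h)

/-- An odd vertex is touched. -/
theorem exists_mem_of_odd (I : LocalMap 4 n m) {D : Finset (Fin m)} {w : Fin n} (hw : Odd (xpdeg I D w)) :
    ∃ j ∈ D, w ∈ xpair I j := by
  by_contra hno
  push Not at hno
  have h0 : xpdeg I D w = 0 := by
    unfold xpdeg pdeg
    rw [card_eq_zero.2, card_eq_zero.2]
    · exact filter_eq_empty_iff.2 fun j hj h => hno j hj ((mem_xpair I).2 (Or.inr h.symm))
    · exact filter_eq_empty_iff.2 fun j hj h => hno j hj ((mem_xpair I).2 (Or.inl h.symm))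
  rw [h0] at hw
  exact (Nat.not_odd_iff_even.2 (by decide)) hw

/-- An output whose XOR pair contains both ends of `e ≠ j` violates simple overlaps. -/
theorem false_of_both_ends (I : LocalMap 4 n m) (hI : I.IsPure xorAndPred) (hS : SimpleOverlap I) {e j : Fin m} (hne : j ≠ e)
    (h0 : I.vars e 0 ∈ xpair I j) (h1 : I.vars e 1 ∈ xpair I j) : False := by
  have h01 : I.vars e 0 ≠ I.vars e 1 := fun h => absurd (hI.2 e h) (by decide)
  have hsub : ∀ {u}, u ∈ xpair I j → u ∈ varSet I j := fun hu => by
    rcases (mem_xpair I).1 hu with rfl | rfl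
    · exact vars_mem_varSet I j 0
    · exact vars_mem_varSet I j 1
  exact not_two_shared I hS hne h01 (hsub h0) (vars_mem_varSet I e 0) (hsub h1) (vars_mem_varSet I e 1)

/-- **A fundamental set has at least two outputs** (one output would be parallel to `e`). -/
theorem two_le_card_of_even (I : LocalMap 4 n m) (hI : I.IsPure xorAndPred) (hS : SimpleOverlap I) {D : Finset (Fin m)} {e : Fin m}
    (he : e ∉ D) (heven : ∀ w, Even (xpdeg I (insert e D) w)) : 2 ≤ D.card := by
  obtain ⟨j, hj, hj0⟩ := exists_mem_of_odd I (odd_of_end I hI he heven (s := 0) (by decide))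
  by_contra hlt
  have hD : D = {j} := by
    apply eq_singleton_iff_unique_mem.2 ⟨hj, fun j' hj' => ?_⟩
    by_contra hne
    have : 2 ≤ D.card := by
      have hsub : ({j, j'} : Finset (Fin m)) ⊆ D := by
        intro i hi
        rcases mem_insert.1 hi with rfl | hi
        · exact hj
        · rw [mem_singleton.1 hi]; exact hj'
      have := card_le_card hsub
      rw [card_pair (Ne.symm hne)] at this
      exact this
    exact hlt this
  obtain ⟨j', hj', hj'1⟩ := exists_mem_of_odd I (odd_of_end I hI he heven (s := 1) (by decide))
  rw [hD, mem_singleton] at hj'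
  rw [hj'] at hj'1
  have hne : j ≠ e := fun h => he (h ▸ hj)
  exact false_of_both_ends I hI hS hne hj0 hj'1

/-- Double counting: the slot-degrees of `D` sum to `2·#D`. -/
theorem sum_xpdeg (I : LocalMap 4 n m) (D : Finset (Fin m)) : ∑ w, xpdeg I D w = 2 * D.card := by
  unfold xpdeg pdeg
  rw [sum_add_distrib, ← card_eq_sum_card_fiberwise fun j _ => mem_univ (I.vars j 0),
    ← card_eq_sum_card_fiberwise fun j _ => mem_univ (I.vars j 1)]
  ring

/-- **No AND variable is common to all outputs of a fundamental set** (simple overlaps: outputs sharing an AND variable are XOR-disjoint, so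
`D` would be an XOR matching; evenness then makes `D` a single output parallel to `e`). -/
theorem not_star_of_even (I : LocalMap 4 n m) (hI : I.IsPure xorAndPred) (hS : SimpleOverlap I) {D : Finset (Fin m)} {e : Fin m}
    (he : e ∉ D) (heven : ∀ w, Even (xpdeg I (insert e D) w)) : ¬ ∃ d : Fin n, ∀ j ∈ D, d ∈ andPair I j := by
  rintro ⟨d, hd⟩
  -- every vertex has slot-degree ≤ 1 in `D`
  have hle : ∀ w, xpdeg I D w ≤ 1 := by
    intro w
    have key : ∀ j ∈ D, ∀ j' ∈ D, w ∈ xpair I j → w ∈ xpair I j' → j = j' := by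
      intro j hj j' hj' hw hw'
      by_contra hne
      have hdw : d ≠ w := by
        intro hdw
        rcases (mem_andPair_iff I j d).1 (hd j hj) with h2 | h3
        · rcases (mem_xpair I).1 hw with h0 | h1
          · exact absurd (hI.2 j (h2.symm.trans (hdw.trans h0))) (by decide)
          · exact absurd (hI.2 j (h2.symm.trans (hdw.trans h1))) (by decide)
        · rcases (mem_xpair I).1 hw with h0 | h1
          · exact absurd (hI.2 j (h3.symm.trans (hdw.trans h0))) (by decide)
          · exact absurd (hI.2 j (h3.symm.trans (hdw.trans h1))) (by decide)
      have hsub : ∀ {i u}, u ∈ xpair I i → u ∈ varSet I i := fun {i u} hu => by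
        rcases (mem_xpair I).1 hu with rfl | rfl
        · exact vars_mem_varSet I i 0
        · exact vars_mem_varSet I i 1
      exact not_two_shared I hS hne hdw (andPair_subset_varSet I j (hd j hj)) (andPair_subset_varSet I j' (hd j' hj')) (hsub hw) (hsub hw')
    -- both filters lie in the (≤ 1)-element set of outputs touching `w`, and are disjoint
    unfold xpdeg pdeg
    rw [← card_union_of_disjoint]
    · refine Nat.le_of_lt_succ (Nat.lt_succ_of_le (card_le_one.2 fun j hj j' hj' => ?_))
      rw [mem_union, mem_filter, mem_filter] at hj hj'
      have hwj : j ∈ D ∧ w ∈ xpair I j := by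
        rcases hj with ⟨h, h'⟩ | ⟨h, h'⟩
        · exact ⟨h, (mem_xpair I).2 (Or.inl h'.symm)⟩
        · exact ⟨h, (mem_xpair I).2 (Or.inr h'.symm)⟩
      have hwj' : j' ∈ D ∧ w ∈ xpair I j' := by
        rcases hj' with ⟨h, h'⟩ | ⟨h, h'⟩
        · exact ⟨h, (mem_xpair I).2 (Or.inl h'.symm)⟩
        · exact ⟨h, (mem_xpair I).2 (Or.inr h'.symm)⟩
      exact key j hwj.1 j' hwj'.1 hwj.2 hwj'.2
    · rw [disjoint_left]
      intro j hj hj'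
      rw [mem_filter] at hj hj'
      exact absurd (hI.2 j (hj.2.trans hj'.2.symm)) (by decide)
  -- even and ≤ 1 ⟹ 0 off the ends of `e`; so the degrees sum to ≤ 2
  have hzero : ∀ w, w ∉ xpair I e → xpdeg I D w = 0 := by
    intro w hw
    have h1 := hle w
    by_contra hne
    have hodd : Odd (xpdeg I D w) := by
      have : xpdeg I D w = 1 := by omega
      rw [this]; exact odd_one
    exact hw (mem_xpair_of_odd I he heven hodd)
  have hsum : ∑ w, xpdeg I D w ≤ (xpair I e).card := by
    classical
    rw [← sum_filter_add_sum_filter_not univ (fun w => w ∈ xpair I e)]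
    have hz : ∑ w ∈ univ.filter (fun w => w ∉ xpair I e), xpdeg I D w = 0 :=
      sum_eq_zero fun w hw => hzero w (mem_filter.1 hw).2
    rw [hz, add_zero]
    calc ∑ w ∈ univ.filter (fun w => w ∈ xpair I e), xpdeg I D w ≤ ∑ w ∈ univ.filter (fun w => w ∈ xpair I e), 1 :=
          sum_le_sum fun w _ => hle w
      _ = (univ.filter (fun w => w ∈ xpair I e)).card := by simp
      _ ≤ (xpair I e).card := card_le_card fun w hw => (mem_filter.1 hw).2
  have h2 := two_le_card_of_even I hI hS he heven
  have h3 := card_xpair_le I e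
  rw [sum_xpdeg] at hsum
  omega

/-- **At most two XOR boundary vertices**: a boundary variable of `D` outside all AND pairs of `D` is an odd vertex, hence an end of `e`. -/
theorem card_xor_bdry_le_two_of_even (I : LocalMap 4 n m) (hI : I.IsPure xorAndPred) {D : Finset (Fin m)} {e : Fin m} (he : e ∉ D)
    (heven : ∀ w, Even (xpdeg I (insert e D) w)) :
    ((bdry I D).filter fun v => ∀ j ∈ D, v ∉ andPair I j).card ≤ 2 := by
  refine le_trans (card_le_card fun v hv => ?_) (card_xpair_le I e)
  rw [mem_filter] at hv
  obtain ⟨hvb, hva⟩ := hv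
  apply mem_xpair_of_odd I he heven
  -- `v` is read by exactly one output `j₀` of `D`, through an XOR slot
  have hb1 : (D.filter fun j => v ∈ varSet I j).card = 1 := by
    unfold PstarSALevel.bdry at hvb
    exact (mem_filter.1 hvb).2
  obtain ⟨j₀, hj₀⟩ := card_eq_one.1 hb1
  have hj₀m : j₀ ∈ D.filter fun j => v ∈ varSet I j := by rw [hj₀]; exact mem_singleton_self _
  rw [mem_filter] at hj₀m
  have hsub0 : D.filter (fun j => I.vars j 0 = v) ⊆ {j₀} := fun j hj => by
    rw [← hj₀]; rw [mem_filter] at hj ⊢; exact ⟨hj.1, hj.2 ▸ vars_mem_varSet I j 0⟩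
  have hsub1 : D.filter (fun j => I.vars j 1 = v) ⊆ {j₀} := fun j hj => by
    rw [← hj₀]; rw [mem_filter] at hj ⊢; exact ⟨hj.1, hj.2 ▸ vars_mem_varSet I j 1⟩
  have hdisj : Disjoint (D.filter fun j => I.vars j 0 = v) (D.filter fun j => I.vars j 1 = v) := by
    rw [disjoint_left]
    intro j hj hj'
    rw [mem_filter] at hj hj'
    exact absurd (hI.2 j (hj.2.trans hj'.2.symm)) (by decide)
  have hle : xpdeg I D v ≤ 1 := by
    unfold xpdeg pdeg
    rw [← card_union_of_disjoint hdisj]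
    exact (card_le_card (union_subset hsub0 hsub1)).trans (card_singleton j₀).le
  have hge : 1 ≤ xpdeg I D v := by
    -- `j₀` reads `v` through slot `0` or `1` (not an AND slot, by `hva`)
    obtain ⟨s, hs⟩ : ∃ s : Fin 4, I.vars j₀ s = v := by
      have := hj₀m.2
      unfold PstarSALevel.varSet at this
      obtain ⟨s, -, hs⟩ := mem_image.1 this
      exact ⟨s, hs⟩
    have hs01 : s = 0 ∨ s = 1 := by
      have hna := hva j₀ hj₀m.1
      rw [mem_andPair_iff] at hna
      push Not at hna
      have : s ≠ 2 := fun h => hna.1 (by rw [← hs, h])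
      have : s ≠ 3 := fun h => hna.2 (by rw [← hs, h])
      rcases s with ⟨s, h4⟩
      simp only [Fin.ext_iff, ne_eq] at *
      omega
    change 1 ≤ (D.filter fun j => I.vars j 0 = v).card + (D.filter fun j => I.vars j 1 = v).card
    rcases hs01 with rfl | rfl
    · have hmem : j₀ ∈ D.filter fun j => I.vars j 0 = v := mem_filter.2 ⟨hj₀m.1, hs⟩
      have := card_pos.2 ⟨j₀, hmem⟩
      omega
    · have hmem : j₀ ∈ D.filter fun j => I.vars j 1 = v := mem_filter.2 ⟨hj₀m.1, hs⟩
      have := card_pos.2 ⟨j₀, hmem⟩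
      omega
  have : xpdeg I D v = 1 := le_antisymm hle hge
  rw [this]; exact odd_one

/-- **Equal fundamental sets force equal chords**: the ends of a chord are the odd vertices of its fundamental set. -/
theorem eq_of_fundamental_eq (I : LocalMap 4 n m) (hI : I.IsPure xorAndPred) (hS : SimpleOverlap I) {D : Finset (Fin m)}
    {e e' : Fin m} (he : e ∉ D) (he' : e' ∉ D) (heven : ∀ w, Even (xpdeg I (insert e D) w))
    (heven' : ∀ w, Even (xpdeg I (insert e' D) w)) : e = e' := by
  by_contra hne
  have h0 : I.vars e 0 ∈ xpair I e' := mem_xpair_of_odd I he' heven' (odd_of_end I hI he heven (s := 0) (by decide))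
  have h1 : I.vars e 1 ∈ xpair I e' := mem_xpair_of_odd I he' heven' (odd_of_end I hI he heven (s := 1) (by decide))
  exact false_of_both_ends I hI hS (Ne.symm hne) h0 h1

end Summit.PneNP.PneNP.Theorems.PstarChordBridgeFundamental
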